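import Summits.HubbardSuperconductivity.HubbardSuperconductivity.Theorems.AnisotropyChordTransferFibre3RowDLoopWNorms
import Summits.HubbardSuperconductivity.HubbardSuperconductivity.Theorems.AnisotropyChordTransferFibre3RowDTLoopW
import Summits.HubbardSuperconductivity.HubbardSuperconductivity.Theorems.AnisotropyChordTransferFibre3RowDTLoopBdry
import Summits.HubbardSuperconductivity.HubbardSuperconductivity.Theorems.AnisotropyChordTransferFibre3ManifoldA64

/-!
# Route `AnisotropyChord` / H0 rotor rung, row D (KT-2a) on the t-BLOCKS: block twin of `…AnisotropyChordTransferFibre3RowDLoopWNorms`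

T-FORK (p2 g8; inventory memo HOME/hubbard-h0-rotor-p2/TBLOCK-INVENTORY-g8.md §3): the theorems of `…RowDLoopWNorms` that carry the
hypothesis `128 ≤ L` (or the `L2.NamedCell` cell box) restated in the namespace `RowD.T` with the SAME names for the t-blocks of
the range `48 ≤ L < 128` (route-lead ruling R1): analytic layer with `64 ≤ L` (family A at `L ≥ 64`: `ManifoldA.nu_ceiling64`,
`manifold_band64`), cell layer on block cells `c : L2.TCell` (`cellBoxB (c.box a₁ a₂)`, `pmem_xTrueT`,
`RowC.finalVec_mem_of_cellFinalBoxT`).  Definitions that do not depend on the cell are NOT duplicated (they resolve to `RowD`);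
proofs are verbatim.  Kept: norm_loopPartU_w12_leC, norm_loopPartU_w31_leC, norm_loopPartU_w32_leC, norm_nLoopU_leC, norm_nvLoopU_leC, norm_loop2_pg_leC, norm_Cline_leC, norm_Cline_leC', norm_Cline_leC'', norm_bLoopU_leC.
Prover seat `hubbard-h0-rotor-p2` g8; helper for piece A = stmt-HubbardSuperconductivity-23918 of rung 19089 (`--supports`, helper
class).  Nothing here proves superconductivity in the Hubbard model; lemmas for ONE row of ONE conditional reduction on the t-blocks;
the rotor TARGET as originally worded stays FALSE (g15 verdict).  Tree imports only; no sorry.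
-/

set_option linter.dupNamespace false
set_option autoImplicit false

open scoped BigOperators

namespace Summit.HubbardSuperconductivity.HubbardSuperconductivity.Theorems.AnisotropyChord.Transfer.Fibre3

namespace RowD

namespace T

open RowC L2.N1

variable (L : ℕ) [NeZero L]

/-! ## N-loops -/

section nloops
variable (Δ lam2 : ℝ) (f : Tor L → ℝ)

/-- ★ pattern `w12` (slot 3 plain), generic zone constant: `‖loopPartU(ψ₃⁰, ψ₁ʷ, ψ₂ʷ′)‖ ≤ bnd3(k3; k1, k2)/V`. [folklore] -/
theorem norm_loopPartU_w12_leC {c : ℝ} (hc : 0 ≤ c)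
    (hwg : ∀ q : Tor L, ∀ e ∈ E4, (wnorm L q (B1.toTor L e) * gres L lam2 q) ^ 2 ≤ c * gres L lam2 q) (hL : 64 ≤ L) (hΔ0 : 0 ≤ Δ) (hΔ1 : Δ < 1) (hf : IsGroundTwoMagnon L Δ lam2 f) (k3 k1 k2 : Bool) (e0 : Tor L) {e e' : ℤ × ℤ}
    (he : e ∈ E4) (he' : e' ∈ E4) (k₂ k₃ : Tor L) :
    ‖loopPartU L lam2 (psiU L Δ lam2 f k3 1 0 e0) (psiU L Δ lam2 f k1 1 (-1) (B1.toTor L e)) (psiU L Δ lam2 f k2 1 (-1) (B1.toTor L e')) k₂ k₃‖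
      ≤ bnd3AtC L Δ lam2 f c k3 k1 k2 / (L : ℝ) ^ 2 := by
  rw [norm_loopPartU_eq]
  have h := norm_loop3w_leC L Δ lam2 f hc hwg hL hΔ0 hΔ1 hf k3 k1 k2 e0 he he' false 0 false k₂ true k₃
  simp only [affine_false, affine_true, zero_add] at h
  exact div_le_div_of_nonneg_right h (by positivity)

/-- ★ pattern `w31` (slot 2 plain), generic zone constant: `‖loopPartU(ψ₃ʷ, ψ₁ʷ′, ψ₂⁰)‖ ≤ bnd3(k2; k3, k1)/V`. [folklore] -/
theorem norm_loopPartU_w31_leC {c : ℝ} (hc : 0 ≤ c)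
    (hwg : ∀ q : Tor L, ∀ e ∈ E4, (wnorm L q (B1.toTor L e) * gres L lam2 q) ^ 2 ≤ c * gres L lam2 q) (hL : 64 ≤ L) (hΔ0 : 0 ≤ Δ) (hΔ1 : Δ < 1) (hf : IsGroundTwoMagnon L Δ lam2 f) (k3 k1 k2 : Bool) (e0 : Tor L) {e e' : ℤ × ℤ}
    (he : e ∈ E4) (he' : e' ∈ E4) (k₂ k₃ : Tor L) :
    ‖loopPartU L lam2 (psiU L Δ lam2 f k3 1 (-1) (B1.toTor L e)) (psiU L Δ lam2 f k1 1 (-1) (B1.toTor L e')) (psiU L Δ lam2 f k2 1 0 e0) k₂ k₃‖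
      ≤ bnd3AtC L Δ lam2 f c k2 k3 k1 / (L : ℝ) ^ 2 := by
  rw [norm_loopPartU_eq]
  have h := norm_loop3w_leC L Δ lam2 f hc hwg hL hΔ0 hΔ1 hf k2 k3 k1 e0 he he' true k₃ false 0 false k₂
  simp only [affine_false, affine_true, zero_add] at h
  refine div_le_div_of_nonneg_right (le_of_eq_of_le ?_ h) (by positivity)
  congr 1; exact Finset.sum_congr rfl fun p _ => by ring

/-- ★ pattern `w32` (slot 1 plain), generic zone constant: `‖loopPartU(ψ₃ʷ, ψ₁⁰, ψ₂ʷ′)‖ ≤ bnd3(k1; k3, k2)/V`. [folklore] -/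
theorem norm_loopPartU_w32_leC {c : ℝ} (hc : 0 ≤ c)
    (hwg : ∀ q : Tor L, ∀ e ∈ E4, (wnorm L q (B1.toTor L e) * gres L lam2 q) ^ 2 ≤ c * gres L lam2 q) (hL : 64 ≤ L) (hΔ0 : 0 ≤ Δ) (hΔ1 : Δ < 1) (hf : IsGroundTwoMagnon L Δ lam2 f) (k3 k1 k2 : Bool) (e0 : Tor L) {e e' : ℤ × ℤ}
    (he : e ∈ E4) (he' : e' ∈ E4) (k₂ k₃ : Tor L) :
    ‖loopPartU L lam2 (psiU L Δ lam2 f k3 1 (-1) (B1.toTor L e)) (psiU L Δ lam2 f k1 1 0 e0) (psiU L Δ lam2 f k2 1 (-1) (B1.toTor L e')) k₂ k₃‖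
      ≤ bnd3AtC L Δ lam2 f c k1 k3 k2 / (L : ℝ) ^ 2 := by
  rw [norm_loopPartU_eq]
  have h := norm_loop3w_leC L Δ lam2 f hc hwg hL hΔ0 hΔ1 hf k1 k3 k2 e0 he he' false k₂ false 0 true k₃
  simp only [affine_false, affine_true, zero_add] at h
  refine div_le_div_of_nonneg_right (le_of_eq_of_le ?_ h) (by positivity)
  congr 1; exact Finset.sum_congr rfl fun p _ => by ring


/-- ★ generic constant: `‖nLoopU(q₂,q₃)‖ ≤ 2·bnd3SumC/V` (four `e ∈ nnList`, prefactor `½`). [folklore] -/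
theorem norm_nLoopU_leC {c : ℝ} (hc : 0 ≤ c)
    (hwg : ∀ q : Tor L, ∀ e ∈ E4, (wnorm L q (B1.toTor L e) * gres L lam2 q) ^ 2 ≤ c * gres L lam2 q) (hL : 64 ≤ L) (hΔ0 : 0 ≤ Δ) (hΔ1 : Δ < 1) (hf : IsGroundTwoMagnon L Δ lam2 f) (k3 k1 k2 : Bool) (e0 q₂ q₃ : Tor L) :
    ‖nLoopU L Δ lam2 f k3 k1 k2 e0 q₂ q₃‖ ≤ 2 * (bnd3SumC L Δ lam2 f c k3 k1 k2 / (L : ℝ) ^ 2) := by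
  have T : ∀ e ∈ E4,
      ‖loopPartU L lam2 (psiU L Δ lam2 f k3 1 0 e0) (psiU L Δ lam2 f k1 1 (-1) (B1.toTor L e)) (psiU L Δ lam2 f k2 1 (-1) (B1.toTor L e)) q₂ q₃
        + loopPartU L lam2 (psiU L Δ lam2 f k3 1 (-1) (B1.toTor L e)) (psiU L Δ lam2 f k1 1 (-1) (-(B1.toTor L e))) (psiU L Δ lam2 f k2 1 0 e0) q₂ q₃
        + loopPartU L lam2 (psiU L Δ lam2 f k3 1 (-1) (B1.toTor L e)) (psiU L Δ lam2 f k1 1 0 e0) (psiU L Δ lam2 f k2 1 (-1) (B1.toTor L e)) q₂ q₃‖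
      ≤ bnd3SumC L Δ lam2 f c k3 k1 k2 / (L : ℝ) ^ 2 := by
    intro e he
    have hne := neg_mem_E4 e he
    have A := norm_loopPartU_w12_leC L Δ lam2 f hc hwg hL hΔ0 hΔ1 hf k3 k1 k2 e0 he he q₂ q₃
    have B := norm_loopPartU_w31_leC L Δ lam2 f hc hwg hL hΔ0 hΔ1 hf k3 k1 k2 e0 he hne q₂ q₃
    have C := norm_loopPartU_w32_leC L Δ lam2 f hc hwg hL hΔ0 hΔ1 hf k3 k1 k2 e0 he he q₂ q₃
    rw [B1.toTor_neg] at B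
    unfold bnd3SumC
    calc _ ≤ ‖loopPartU L lam2 (psiU L Δ lam2 f k3 1 0 e0) (psiU L Δ lam2 f k1 1 (-1) (B1.toTor L e)) (psiU L Δ lam2 f k2 1 (-1) (B1.toTor L e)) q₂ q₃
          + loopPartU L lam2 (psiU L Δ lam2 f k3 1 (-1) (B1.toTor L e)) (psiU L Δ lam2 f k1 1 (-1) (-(B1.toTor L e))) (psiU L Δ lam2 f k2 1 0 e0) q₂ q₃‖
          + ‖loopPartU L lam2 (psiU L Δ lam2 f k3 1 (-1) (B1.toTor L e)) (psiU L Δ lam2 f k1 1 0 e0) (psiU L Δ lam2 f k2 1 (-1) (B1.toTor L e)) q₂ q₃‖ :=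
          norm_add_le _ _
      _ ≤ _ := by
          have := norm_add_le
            (loopPartU L lam2 (psiU L Δ lam2 f k3 1 0 e0) (psiU L Δ lam2 f k1 1 (-1) (B1.toTor L e)) (psiU L Δ lam2 f k2 1 (-1) (B1.toTor L e)) q₂ q₃)
            (loopPartU L lam2 (psiU L Δ lam2 f k3 1 (-1) (B1.toTor L e)) (psiU L Δ lam2 f k1 1 (-1) (-(B1.toTor L e))) (psiU L Δ lam2 f k2 1 0 e0) q₂ q₃)
          rw [add_div, add_div]
          linarith
  have e1 := T (1, 0) (by decide)
  have e2 := T (-1, 0) (by decide)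
  have e3 := T (0, 1) (by decide)
  have e4 := T (0, -1) (by decide)
  unfold nLoopU
  rw [nnList_eq_map]
  simp only [E4, List.map, List.sum_cons, List.sum_nil, add_zero, norm_mul, norm_neg, norm_div, norm_one,
    Complex.norm_ofNat]
  have hs := norm_add_le_of_le e1 (norm_add_le_of_le e2 (norm_add_le_of_le e3 e4))
  refine (mul_le_mul_of_nonneg_left hs (by norm_num)).trans (le_of_eq ?_)
  ring

/-- ★ generic constant: `‖nvLoopU(k₂,k₃)‖ ≤ 6·bnd3SumC/V` (three translates). [folklore] -/
theorem norm_nvLoopU_leC {c : ℝ} (hc : 0 ≤ c)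
    (hwg : ∀ q : Tor L, ∀ e ∈ E4, (wnorm L q (B1.toTor L e) * gres L lam2 q) ^ 2 ≤ c * gres L lam2 q) (hL : 64 ≤ L) (hΔ0 : 0 ≤ Δ) (hΔ1 : Δ < 1) (hf : IsGroundTwoMagnon L Δ lam2 f) (k3 k1 k2 : Bool) (e0 k₂ k₃ : Tor L) :
    ‖nvLoopU L Δ lam2 f k3 k1 k2 e0 k₂ k₃‖ ≤ 6 * (bnd3SumC L Δ lam2 f c k3 k1 k2 / (L : ℝ) ^ 2) := by
  unfold nvLoopU
  have h1 := norm_nLoopU_leC L Δ lam2 f hc hwg hL hΔ0 hΔ1 hf k3 k1 k2 e0 k₂ k₃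
  have h2 := norm_nLoopU_leC L Δ lam2 f hc hwg hL hΔ0 hΔ1 hf k3 k1 k2 e0 (k₂ - K1 L) k₃
  have h3 := norm_nLoopU_leC L Δ lam2 f hc hwg hL hΔ0 hΔ1 hf k3 k1 k2 e0 k₂ (k₃ - K1 L)
  have := norm_add_le_of_le (norm_add_le_of_le h1 h2) h3
  linarith

end nloops

/-! ## The boundary loop half -/

section two
variable (Δ lam2 : ℝ) (f : Tor L → ℝ)

/-- ★ plain × gradient, generic zone constant: `‖loop2U(ψ_k plain, ψ_k′ grad ē)(q)‖ ≤ bpg(k,k′)/V` (`e ∈ E4`; any plain vector). [folklore] -/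
theorem norm_loop2_pg_leC {c : ℝ} (hc : 0 ≤ c)
    (hwg : ∀ q : Tor L, ∀ e ∈ E4, (wnorm L q (B1.toTor L e) * gres L lam2 q) ^ 2 ≤ c * gres L lam2 q) (hL : 64 ≤ L) (hΔ0 : 0 ≤ Δ) (hΔ1 : Δ < 1) (hf : IsGroundTwoMagnon L Δ lam2 f) (k k' : Bool) (e0 : Tor L) {e : ℤ × ℤ} (he : e ∈ E4) (q : Tor L) :
    ‖loop2U L lam2 (psiU L Δ lam2 f k 1 0 e0) (psiU L Δ lam2 f k' 1 (-1) (B1.toTor L e)) q‖ ≤ bpgAtC L Δ lam2 f c k k' / (L : ℝ) ^ 2 := by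
  rw [norm_loop2U_eq]
  refine div_le_div_of_nonneg_right ?_ (by positivity)
  obtain ⟨ha0', hcs0', -, hν, _⟩ := slot_regime L Δ lam2 f hL hΔ0 hΔ1 hf
  set a := Δ * f (K1 L) with ha
  set cs := cS L Δ lam2 f with hcs
  set g := gres L lam2 with hg
  have ha0 : 0 ≤ a := ha0'
  have hcs0 : 0 ≤ cs := hcs0'
  have hg0 : ∀ q, 0 ≤ g q := fun q => g_nonneg L hν q
  have hw0 : ∀ q e, 0 ≤ wnorm L q e := fun q e => wnorm_nonneg L q e
  have hw2 : ∀ q e, wnorm L q e ≤ 2 := fun q e => wnorm_le_two L q e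
  refine (norm_sum_le _ _).trans ?_
  simp only [norm_mul, norm_plain L Δ lam2 f hL hΔ0 hΔ1 hf, norm_grad L Δ lam2 f hL hΔ0 hΔ1 hf]
  unfold bpgAtC bpg
  cases k <;> cases k' <;> simp only [Bool.false_eq_true, if_false, if_true, ← ha, ← hcs, ← hg]
  · -- J J
    calc ∑ p, a * (wnorm L (q - p) (B1.toTor L e) * a) ≤ ∑ _p : Tor L, a * (2 * a) :=
          Finset.sum_le_sum fun p _ => by nlinarith [hw2 (q - p) (B1.toTor L e), hw0 (q - p) (B1.toTor L e), mul_nonneg ha0 ha0]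
      _ = a * (2 * a) * (L : ℝ) ^ 2 := by
          rw [Finset.sum_const, Finset.card_univ, Fintype.card_prod, ZMod.card, nsmul_eq_mul]; push_cast; ring
  · -- J S
    have hf := fam_wC L lam2 hc hν hwg true q he
    simp only [affine_true] at hf
    calc ∑ p, a * (wnorm L (q - p) (B1.toTor L e) * (cs * g (q - p)))
        = a * cs * ∑ p, wnorm L (q - p) (B1.toTor L e) * g (q - p) := by
          rw [Finset.mul_sum]; exact Finset.sum_congr rfl fun p _ => by ring
      _ ≤ a * cs * Real.sqrt (c * S1n L lam2 * (L : ℝ) ^ 2) := by gcongr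
  · -- S J
    have hf := fam_g L false 0 lam2
    simp only [affine_false, zero_add] at hf
    calc ∑ p, cs * g p * (wnorm L (q - p) (B1.toTor L e) * a) ≤ ∑ p, cs * (2 * a) * g p :=
          Finset.sum_le_sum fun p _ => by
            have h1 := hw2 (q - p) (B1.toTor L e)
            have hx : 0 ≤ cs * g p * a := by have := hg0 p; positivity
            calc cs * g p * (wnorm L (q - p) (B1.toTor L e) * a) = cs * g p * a * wnorm L (q - p) (B1.toTor L e) := by ring
              _ ≤ cs * g p * a * 2 := mul_le_mul_of_nonneg_left h1 hx
              _ = cs * (2 * a) * g p := by ring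
      _ = cs * (2 * a) * S1n L lam2 := by rw [← Finset.mul_sum, hg, hf]
  · -- S S
    have hf := fam_gwC L lam2 hc hν hwg false 0 true q he
    simp only [affine_false, affine_true, zero_add] at hf
    calc ∑ p, cs * g p * (wnorm L (q - p) (B1.toTor L e) * (cs * g (q - p)))
        = cs ^ 2 * ∑ p, g p * (wnorm L (q - p) (B1.toTor L e) * g (q - p)) := by
          rw [Finset.mul_sum]; exact Finset.sum_congr rfl fun p _ => by ring
      _ ≤ cs ^ 2 * Real.sqrt (c * S2n L lam2 * S1n L lam2) := by gcongr

/-- the `C`-part of one line: `‖½ Σ_{e∈nn} [p·Z(x plain, y grad) + p·Z(y plain, x grad)]‖`-type bound, for a general term list. [folklore] -/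
theorem norm_Cline_leC {c : ℝ} (hc : 0 ≤ c)
    (hwg : ∀ q : Tor L, ∀ e ∈ E4, (wnorm L q (B1.toTor L e) * gres L lam2 q) ^ 2 ≤ c * gres L lam2 q) (hL : 64 ≤ L) (hΔ0 : 0 ≤ Δ) (hΔ1 : Δ < 1) (hf : IsGroundTwoMagnon L Δ lam2 f) (x y : Bool) (p : ℝ) (hp : 0 ≤ p) (q : Tor L) :
    ‖(1 / 2 : ℂ) * ((nnList L).map (fun e =>
        ((p : ℝ) : ℂ) * loop2U L lam2 (psiU L Δ lam2 f x 1 0 e) (psiU L Δ lam2 f y 1 (-1) e) q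
        + ((p : ℝ) : ℂ) * loop2U L lam2 (psiU L Δ lam2 f y 1 0 e) (psiU L Δ lam2 f x 1 (-1) e) q)).sum‖
      ≤ 2 * p * (bpgAtC L Δ lam2 f c x y + bpgAtC L Δ lam2 f c y x) / (L : ℝ) ^ 2 := by
  have T : ∀ e ∈ E4,
      ‖((p : ℝ) : ℂ) * loop2U L lam2 (psiU L Δ lam2 f x 1 0 (B1.toTor L e)) (psiU L Δ lam2 f y 1 (-1) (B1.toTor L e)) q
        + ((p : ℝ) : ℂ) * loop2U L lam2 (psiU L Δ lam2 f y 1 0 (B1.toTor L e)) (psiU L Δ lam2 f x 1 (-1) (B1.toTor L e)) q‖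
      ≤ p * (bpgAtC L Δ lam2 f c x y + bpgAtC L Δ lam2 f c y x) / (L : ℝ) ^ 2 := by
    intro e he
    have A := norm_loop2_pg_leC L Δ lam2 f hc hwg hL hΔ0 hΔ1 hf x y (B1.toTor L e) he q
    have B := norm_loop2_pg_leC L Δ lam2 f hc hwg hL hΔ0 hΔ1 hf y x (B1.toTor L e) he q
    have hpn : ‖((p : ℝ) : ℂ)‖ = p := by rw [Complex.norm_real, Real.norm_eq_abs, abs_of_nonneg hp]
    refine (norm_add_le_of_le (norm_mul_le_of_le (le_of_eq hpn) A) (norm_mul_le_of_le (le_of_eq hpn) B)).trans (le_of_eq ?_)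
    ring
  have e1 := T (1, 0) (by decide); have e2 := T (-1, 0) (by decide)
  have e3 := T (0, 1) (by decide); have e4 := T (0, -1) (by decide)
  rw [nnList_eq_map]
  simp only [E4, List.map, List.sum_cons, List.sum_nil, add_zero, norm_mul, norm_div, norm_one, Complex.norm_ofNat]
  have hs := norm_add_le_of_le e1 (norm_add_le_of_le e2 (norm_add_le_of_le e3 e4))
  refine (mul_le_mul_of_nonneg_left hs (by norm_num)).trans (le_of_eq ?_)
  ring

/-- the same with the second pair transform mirrored (`(-e)` vectors), as in the lines `B` and `D`. [folklore] -/
theorem norm_Cline_leC' {c : ℝ} (hc : 0 ≤ c)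
    (hwg : ∀ q : Tor L, ∀ e ∈ E4, (wnorm L q (B1.toTor L e) * gres L lam2 q) ^ 2 ≤ c * gres L lam2 q) (hL : 64 ≤ L) (hΔ0 : 0 ≤ Δ) (hΔ1 : Δ < 1) (hf : IsGroundTwoMagnon L Δ lam2 f) (x y : Bool) (p : ℝ) (hp : 0 ≤ p) (q : Tor L) :
    ‖(1 / 2 : ℂ) * ((nnList L).map (fun e =>
        ((p : ℝ) : ℂ) * (loop2U L lam2 (psiU L Δ lam2 f x 1 0 e) (psiU L Δ lam2 f y 1 (-1) e) q
          + loop2U L lam2 (psiU L Δ lam2 f y 1 0 (-e)) (psiU L Δ lam2 f x 1 (-1) (-e)) q))).sum‖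
      ≤ 2 * p * (bpgAtC L Δ lam2 f c x y + bpgAtC L Δ lam2 f c y x) / (L : ℝ) ^ 2 := by
  have T : ∀ e ∈ E4,
      ‖((p : ℝ) : ℂ) * (loop2U L lam2 (psiU L Δ lam2 f x 1 0 (B1.toTor L e)) (psiU L Δ lam2 f y 1 (-1) (B1.toTor L e)) q
        + loop2U L lam2 (psiU L Δ lam2 f y 1 0 (-(B1.toTor L e))) (psiU L Δ lam2 f x 1 (-1) (-(B1.toTor L e))) q)‖
      ≤ p * (bpgAtC L Δ lam2 f c x y + bpgAtC L Δ lam2 f c y x) / (L : ℝ) ^ 2 := by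
    intro e he
    have hne := neg_mem_E4 e he
    have A := norm_loop2_pg_leC L Δ lam2 f hc hwg hL hΔ0 hΔ1 hf x y (B1.toTor L e) he q
    have B := norm_loop2_pg_leC L Δ lam2 f hc hwg hL hΔ0 hΔ1 hf y x (-(B1.toTor L e)) hne q
    rw [B1.toTor_neg] at B
    have hpn : ‖((p : ℝ) : ℂ)‖ = p := by rw [Complex.norm_real, Real.norm_eq_abs, abs_of_nonneg hp]
    rw [norm_mul, hpn]
    refine (mul_le_mul_of_nonneg_left (norm_add_le_of_le A B) hp).trans (le_of_eq ?_)
    ring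
  have e1 := T (1, 0) (by decide); have e2 := T (-1, 0) (by decide)
  have e3 := T (0, 1) (by decide); have e4 := T (0, -1) (by decide)
  rw [nnList_eq_map]
  simp only [E4, List.map, List.sum_cons, List.sum_nil, add_zero, norm_mul, norm_div, norm_one, Complex.norm_ofNat]
  have hs := norm_add_le_of_le e1 (norm_add_le_of_le e2 (norm_add_le_of_le e3 e4))
  refine (mul_le_mul_of_nonneg_left hs (by norm_num)).trans (le_of_eq ?_)
  ring

/-- as `norm_Cline_le'` with the two summands in the other order (line `D`). [folklore] -/
theorem norm_Cline_leC'' {c : ℝ} (hc : 0 ≤ c)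
    (hwg : ∀ q : Tor L, ∀ e ∈ E4, (wnorm L q (B1.toTor L e) * gres L lam2 q) ^ 2 ≤ c * gres L lam2 q) (hL : 64 ≤ L) (hΔ0 : 0 ≤ Δ) (hΔ1 : Δ < 1) (hf : IsGroundTwoMagnon L Δ lam2 f) (x y : Bool) (p : ℝ) (hp : 0 ≤ p) (q : Tor L) :
    ‖(1 / 2 : ℂ) * ((nnList L).map (fun e =>
        ((p : ℝ) : ℂ) * (loop2U L lam2 (psiU L Δ lam2 f y 1 0 (-e)) (psiU L Δ lam2 f x 1 (-1) (-e)) q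
          + loop2U L lam2 (psiU L Δ lam2 f x 1 0 e) (psiU L Δ lam2 f y 1 (-1) e) q))).sum‖
      ≤ 2 * p * (bpgAtC L Δ lam2 f c x y + bpgAtC L Δ lam2 f c y x) / (L : ℝ) ^ 2 := by
  have T : ∀ e ∈ E4,
      ‖((p : ℝ) : ℂ) * (loop2U L lam2 (psiU L Δ lam2 f y 1 0 (-(B1.toTor L e))) (psiU L Δ lam2 f x 1 (-1) (-(B1.toTor L e))) q
        + loop2U L lam2 (psiU L Δ lam2 f x 1 0 (B1.toTor L e)) (psiU L Δ lam2 f y 1 (-1) (B1.toTor L e)) q)‖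
      ≤ p * (bpgAtC L Δ lam2 f c x y + bpgAtC L Δ lam2 f c y x) / (L : ℝ) ^ 2 := by
    intro e he
    have hne := neg_mem_E4 e he
    have A := norm_loop2_pg_leC L Δ lam2 f hc hwg hL hΔ0 hΔ1 hf x y (B1.toTor L e) he q
    have B := norm_loop2_pg_leC L Δ lam2 f hc hwg hL hΔ0 hΔ1 hf y x (-(B1.toTor L e)) hne q
    rw [B1.toTor_neg] at B
    have hpn : ‖((p : ℝ) : ℂ)‖ = p := by rw [Complex.norm_real, Real.norm_eq_abs, abs_of_nonneg hp]
    rw [norm_mul, hpn]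
    refine (mul_le_mul_of_nonneg_left (norm_add_le_of_le B A) hp).trans (le_of_eq ?_)
    ring
  have e1 := T (1, 0) (by decide); have e2 := T (-1, 0) (by decide)
  have e3 := T (0, 1) (by decide); have e4 := T (0, -1) (by decide)
  rw [nnList_eq_map]
  simp only [E4, List.map, List.sum_cons, List.sum_nil, add_zero, norm_mul, norm_div, norm_one, Complex.norm_ofNat]
  have hs := norm_add_le_of_le e1 (norm_add_le_of_le e2 (norm_add_le_of_le e3 e4))
  refine (mul_le_mul_of_nonneg_left hs (by norm_num)).trans (le_of_eq ?_)
  ring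

/-- ★ THE BOUNDARY LOOP BOUND, generic zone constant: `‖bLoopU(k̄₂,k̄₃)‖ ≤ [p₁·lineBnd(k3,k2) + p₂·lineBnd(k3,k1) + p₃·lineBnd(k2,k1)]/V`
(any torus momenta; `p_i = pvR kind_i`). [folklore] -/
theorem norm_bLoopU_leC {c : ℝ} (hc : 0 ≤ c)
    (hwg : ∀ q : Tor L, ∀ e ∈ E4, (wnorm L q (B1.toTor L e) * gres L lam2 q) ^ 2 ≤ c * gres L lam2 q) (hL : 64 ≤ L) (hΔ0 : 0 ≤ Δ) (hΔ1 : Δ < 1) (hf : IsGroundTwoMagnon L Δ lam2 f) (k3 k1 k2 : Bool) (k₂ k₃ : Tor L) :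
    ‖bLoopU L Δ lam2 f k3 k1 k2 k₂ k₃‖
      ≤ (pvR L Δ lam2 f k1 * lineBndC L Δ lam2 f c k3 k2 + pvR L Δ lam2 f k2 * lineBndC L Δ lam2 f c k3 k1
          + pvR L Δ lam2 f k3 * lineBndC L Δ lam2 f c k2 k1) / (L : ℝ) ^ 2 := by
  have p1 := pvR_nonneg L Δ lam2 f hL hΔ0 hΔ1 hf k1
  have p2 := pvR_nonneg L Δ lam2 f hL hΔ0 hΔ1 hf k2
  have p3 := pvR_nonneg L Δ lam2 f hL hΔ0 hΔ1 hf k3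
  set P1 := pvR L Δ lam2 f k1
  set P2 := pvR L Δ lam2 f k2
  set P3 := pvR L Δ lam2 f k3
  -- line A: slots (b ↦ k2, b−a ↦ k3), point value p₁
  have CA := fun q => norm_Cline_leC L Δ lam2 f hc hwg hL hΔ0 hΔ1 hf k3 k2 P1 p1 q
  have MA := norm_Mline_le L Δ lam2 f hL hΔ0 hΔ1 hf k2 k3 P1 p1 false k₃
  -- line B: (k3, k1), p₂
  have CB := fun q => norm_Cline_leC' L Δ lam2 f hc hwg hL hΔ0 hΔ1 hf k3 k1 P2 p2 q
  have MB := norm_Mline_le L Δ lam2 f hL hΔ0 hΔ1 hf k1 k3 P2 p2 false k₂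
  -- line D: (k2, k1), p₃ ; shifts by `−e`
  have CD := fun q => norm_Cline_leC'' L Δ lam2 f hc hwg hL hΔ0 hΔ1 hf k1 k2 P3 p3 q
  have MD := norm_Mline_le L Δ lam2 f hL hΔ0 hΔ1 hf k1 k2 P3 p3 true (k₂ + k₃ - K1 L)
  simp only [Bool.false_eq_true, if_false, if_true] at MA MB MD
  unfold bLoopU bLinesG
  simp only []
  -- assemble: ‖(2CA + CA + MA) + (2CB + CB + MB) + (CD + 2CD + MD)‖
  have hA := norm_add_le_of_le (norm_add_le_of_le (norm_mul_le_of_le (le_of_eq (by norm_num : ‖(2:ℂ)‖ = 2)) (CA k₃)) (CA (k₃ - K1 L))) MA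
  have hB := norm_add_le_of_le (norm_add_le_of_le (norm_mul_le_of_le (le_of_eq (by norm_num : ‖(2:ℂ)‖ = 2)) (CB k₂)) (CB (k₂ - K1 L))) MB
  have hD := norm_add_le_of_le (norm_add_le_of_le (CD (k₂ + k₃)) (norm_mul_le_of_le (le_of_eq (by norm_num : ‖(2:ℂ)‖ = 2)) (CD (k₂ + k₃ - K1 L)))) MD
  refine (norm_add_le_of_le (norm_add_le_of_le hA hB) hD).trans (le_of_eq ?_)
  unfold lineBndC
  -- `bsp` is symmetric in the two-slot order used
  have s1 : bspAt L Δ lam2 f k2 k3 = bspAt L Δ lam2 f k3 k2 := by cases k2 <;> cases k3 <;> simp only [bspAt, bsp] <;> ring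
  have s2 : bspAt L Δ lam2 f k1 k3 = bspAt L Δ lam2 f k3 k1 := by cases k1 <;> cases k3 <;> simp only [bspAt, bsp] <;> ring
  have s3 : bspAt L Δ lam2 f k1 k2 = bspAt L Δ lam2 f k2 k1 := by cases k1 <;> cases k2 <;> simp only [bspAt, bsp] <;> ring
  rw [s1, s2, s3]
  ring

end two

end T

end RowD

end Summit.HubbardSuperconductivity.HubbardSuperconductivity.Theorems.AnisotropyChord.Transfer.Fibre3
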